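import Summits.Ventures.Crystal3D.StickySpheres.EightCensusSort
import Summits.Ventures.Crystal3D.StickySpheres.EightCensusPatterns3
import Summits.Ventures.Crystal3D.StickySpheres.PrismLink
import HarnessLib

/-!
# The eight-ball census, a vertex of degree three: relabelling, block sorting and the two seven-ball patterns

Venture `Crystal3D` (cell `pub-crystal3d`, seat p2). ENUM-A(b) of `ineq/FORMAL-C9.md`, preliminaries of `EightCensusMinThree`:
`exists_relabel8` (an injective relabelling of `Fin 8` putting a vertex at `7` and its `d` neighbours at `7 − d, …, 6`), the fan
and prism seven-ball patterns in edge-list form (`no_fan7` from the bridged tetrahedral fan, `no_prism7` from the prism link), and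
the block permutations sorting the degrees on `{0,1,2,3}` and on `{4,5,6}` (`exists_blockSort3`; finite checks with `tau` of
`EightCensusSort`).

HONEST FRAMING: finite combinatorics plus two landed pattern lemmas; nothing about crystallization.
-/

noncomputable section

open Finset

namespace Summit.Ventures.Crystal3D

namespace EightCensus3

open EightSearch EightCensus SimpleGraph

/-! ### Relabelling a vertex and its neighbours (`Fin 8` version of `exists_relabel7`) -/

/-- A vertex `w` with a set `N` of `d ≤ 7` "neighbours" (`w ∉ N`) can be moved to `7` with `N` occupying the last `d` labels below
`7`: a bijection `g` with `g 7 = w` and, for `j ≠ 7`, `g j ∈ N ↔ 7 - d ≤ j`. [folklore] -/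
theorem exists_relabel8 (N : Finset (Fin 8)) (w : Fin 8) (hwN : w ∉ N) {d : ℕ} (hN : N.card = d) (hd : d ≤ 7) :
    ∃ g : Fin 8 ≃ Fin 8, g 7 = w ∧ ∀ j : Fin 8, j ≠ 7 → (g j ∈ N ↔ 7 - d ≤ j.val) := by
  classical
  set R : Finset (Fin 8) := univ \ insert w N with hRdef
  have hR : R.card = 7 - d := by
    rw [hRdef, card_univ_sdiff, Fintype.card_fin, card_insert_of_notMem hwN, hN]; omega
  let g : Fin 8 → Fin 8 := fun j =>
    if h1 : j.val < 7 - d then R.orderEmbOfFin hR ⟨j.val, h1⟩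
    else if h2 : j.val < 7 then N.orderEmbOfFin hN ⟨j.val - (7 - d), by omega⟩ else w
  have gR : ∀ j : Fin 8, ∀ h1 : j.val < 7 - d, g j = R.orderEmbOfFin hR ⟨j.val, h1⟩ := fun j h1 => by
    simp only [g, dif_pos h1]
  have gN : ∀ j : Fin 8, ∀ h1 : ¬ j.val < 7 - d, ∀ h2 : j.val < 7,
      g j = N.orderEmbOfFin hN ⟨j.val - (7 - d), by omega⟩ :=
    fun j h1 h2 => by simp only [g, dif_neg h1, dif_pos h2]
  have g7 : ∀ j : Fin 8, ¬ j.val < 7 → g j = w := fun j h2 => by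
    simp only [g, dif_neg (show ¬ j.val < 7 - d by omega), dif_neg h2]
  have memR : ∀ j : Fin 8, j.val < 7 - d → g j ∈ R := fun j h1 => by rw [gR j h1]; exact R.orderEmbOfFin_mem hR _
  have memN : ∀ j : Fin 8, ¬ j.val < 7 - d → j.val < 7 → g j ∈ N := fun j h1 h2 => by
    rw [gN j h1 h2]; exact N.orderEmbOfFin_mem hN _
  have hRN : ∀ v, v ∈ R → v ∉ N := fun v hv hvN => by
    rw [hRdef, mem_sdiff] at hv; exact hv.2 (mem_insert_of_mem hvN)
  have hRw : ∀ v, v ∈ R → v ≠ w := fun v hv hvw => by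
    rw [hRdef, mem_sdiff] at hv; exact hv.2 (hvw ▸ mem_insert_self _ _)
  have hinj : Function.Injective g := by
    intro i j hij
    by_cases hi1 : i.val < 7 - d <;> by_cases hj1 : j.val < 7 - d
    · have e : (⟨i.val, hi1⟩ : Fin (7 - d)) = ⟨j.val, hj1⟩ := by
        apply (R.orderEmbOfFin hR).injective; rw [← gR i hi1, ← gR j hj1, hij]
      exact Fin.ext (by simpa using e)
    · exfalso
      by_cases hj2 : j.val < 7
      · exact hRN _ (memR i hi1) (hij ▸ memN j hj1 hj2)
      · exact hRw _ (memR i hi1) (hij.trans (g7 j hj2))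
    · exfalso
      by_cases hi2 : i.val < 7
      · exact hRN _ (memR j hj1) (hij.symm ▸ memN i hi1 hi2)
      · exact hRw _ (memR j hj1) (hij.symm.trans (g7 i hi2))
    · by_cases hi2 : i.val < 7 <;> by_cases hj2 : j.val < 7
      · have e : (⟨i.val - (7 - d), by omega⟩ : Fin d) = ⟨j.val - (7 - d), by omega⟩ := by
          apply (N.orderEmbOfFin hN).injective; rw [← gN i hi1 hi2, ← gN j hj1 hj2, hij]
        have e' : i.val - (7 - d) = j.val - (7 - d) := by simpa using e
        exact Fin.ext (by omega)
      · exfalso; exact hwN ((g7 j hj2) ▸ hij ▸ memN i hi1 hi2)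
      · exfalso; exact hwN ((g7 i hi2) ▸ hij.symm ▸ memN j hj1 hj2)
      · exact Fin.ext (by omega)
  refine ⟨Equiv.ofBijective g (Finite.injective_iff_bijective.1 hinj), g7 7 (by decide), fun j hj => ?_⟩
  rw [Equiv.ofBijective_apply]
  by_cases h1 : j.val < 7 - d
  · constructor
    · intro h; exact absurd h (hRN _ (memR j h1))
    · intro h; omega
  · have h2 : j.val < 7 := by
      have := j.isLt
      have hne : j.val ≠ 7 := fun h => hj (Fin.ext h)
      omega
    exact ⟨fun _ => by omega, fun _ => memN j h1 h2⟩

/-! ### The fan and prism patterns in list form -/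

/-- The bridged fan as a seven-ball pattern in list form (`FanEdges7`), from `no_tetra_fan_bridge`. [folklore] -/
theorem no_fan7 (p : Fin 7 → EuclideanSpace ℝ (Fin 3))
    (hE : ∀ e ∈ FanEdges7, dist (p e.1) (p e.2) = 1) (hN : ∀ i j : Fin 7, i ≠ j → 1 ≤ dist (p i) (p j)) : False := by
  simp only [FanEdges7, List.forall_mem_cons, List.not_mem_nil, false_implies, implies_true, and_true] at hE
  obtain ⟨h01, h02, h03, h04, h05, h06, h12, h13, h14, h15, h23, h26, h34, h45, h56⟩ := hE
  exact no_tetra_fan_bridge h01 h02 h03 h04 h05 h12 h13 h14 h15 h23 h34 h45 (by rw [dist_comm]; exact h06)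
    (by rw [dist_comm]; exact h56) (by rw [dist_comm]; exact h26) (hN 2 4 (by decide)) (hN 3 5 (by decide))
    (hN 6 1 (by decide))

/-- The prism link as a seven-ball pattern in list form (`PrismEdges7`), from `no_prism_link`. [folklore] -/
theorem no_prism7 (p : Fin 7 → EuclideanSpace ℝ (Fin 3))
    (hE : ∀ e ∈ PrismEdges7, dist (p e.1) (p e.2) = 1) (hN : ∀ i j : Fin 7, i ≠ j → 1 ≤ dist (p i) (p j)) : False := by
  simp only [PrismEdges7, List.forall_mem_cons, List.not_mem_nil, false_implies, implies_true, and_true] at hE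
  obtain ⟨h01, h02, h03, h04, h05, h06, h12, h13, h14, h23, h25, h36, h45, h46, h56⟩ := hE
  exact no_prism_link h01 h02 h03 h04 h05 h06 h12 h13 h23 h45 h46 h56 h14 h25 h36 (hN 1 5 (by decide)) (hN 1 6 (by decide))
    (hN 2 4 (by decide)) (hN 2 6 (by decide)) (hN 3 4 (by decide)) (hN 3 5 (by decide))

/-! ### Block sorting for the blocks `{0,1,2,3}` and `{4,5,6}` (finite checks; `tau` from `EightCensusSort`) -/

/-- The 24 permutations of `Fin 8` permuting `{0,1,2,3}` and fixing the rest (image lists). [folklore] -/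
def T4a : List (List (Fin 8)) :=
  [[0, 1, 2, 3, 4, 5, 6, 7], [0, 1, 3, 2, 4, 5, 6, 7], [0, 2, 1, 3, 4, 5, 6, 7], [0, 2, 3, 1, 4, 5, 6, 7], [0, 3, 1, 2, 4, 5, 6, 7], [0, 3, 2, 1, 4, 5, 6, 7], [1, 0, 2, 3, 4, 5, 6, 7], [1, 0, 3, 2, 4, 5, 6, 7],
   [1, 2, 0, 3, 4, 5, 6, 7], [1, 2, 3, 0, 4, 5, 6, 7], [1, 3, 0, 2, 4, 5, 6, 7], [1, 3, 2, 0, 4, 5, 6, 7], [2, 0, 1, 3, 4, 5, 6, 7], [2, 0, 3, 1, 4, 5, 6, 7], [2, 1, 0, 3, 4, 5, 6, 7], [2, 1, 3, 0, 4, 5, 6, 7],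
   [2, 3, 0, 1, 4, 5, 6, 7], [2, 3, 1, 0, 4, 5, 6, 7], [3, 0, 1, 2, 4, 5, 6, 7], [3, 0, 2, 1, 4, 5, 6, 7], [3, 1, 0, 2, 4, 5, 6, 7], [3, 1, 2, 0, 4, 5, 6, 7], [3, 2, 0, 1, 4, 5, 6, 7], [3, 2, 1, 0, 4, 5, 6, 7]]

/-- The 6 permutations of `Fin 8` permuting `{4,5,6}` and fixing the rest (image lists). [folklore] -/
def T3b : List (List (Fin 8)) := [[0, 1, 2, 3, 4, 5, 6, 7], [0, 1, 2, 3, 4, 6, 5, 7], [0, 1, 2, 3, 5, 4, 6, 7], [0, 1, 2, 3, 5, 6, 4, 7], [0, 1, 2, 3, 6, 4, 5, 7], [0, 1, 2, 3, 6, 5, 4, 7]]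

/-- Block structure of the `T4a` maps. [folklore] -/
theorem T4a_block : ∀ t ∈ T4a, Function.Injective (tau t) ∧ (∀ j : Fin 8, 4 ≤ j.val → tau t j = j) ∧
    (∀ j : Fin 8, j.val < 4 → (tau t j).val < 4) := by
  decide +kernel

/-- Block structure of the `T3b` maps. [folklore] -/
theorem T3b_block : ∀ t ∈ T3b, Function.Injective (tau t) ∧ (∀ j : Fin 8, j.val < 4 → tau t j = j) ∧ tau t 7 = 7 ∧
    (∀ j : Fin 8, 4 ≤ j.val → j.val < 7 → 4 ≤ (tau t j).val ∧ (tau t j).val < 7) := by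
  decide +kernel

/-- Every quadruple is sorted by one of the `T4a` maps. [folklore] -/
theorem sort4a : ∀ a b c d : Fin 8, ∃ t ∈ T4a,
    (![a, b, c, d, 0, 0, 0, 0] : Fin 8 → Fin 8) (tau t 0) ≤ ![a, b, c, d, 0, 0, 0, 0] (tau t 1) ∧
    (![a, b, c, d, 0, 0, 0, 0] : Fin 8 → Fin 8) (tau t 1) ≤ ![a, b, c, d, 0, 0, 0, 0] (tau t 2) ∧
    (![a, b, c, d, 0, 0, 0, 0] : Fin 8 → Fin 8) (tau t 2) ≤ ![a, b, c, d, 0, 0, 0, 0] (tau t 3) := by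
  decide +kernel

/-- Every triple is sorted by one of the `T3b` maps. [folklore] -/
theorem sort3b : ∀ a b c : Fin 8, ∃ t ∈ T3b,
    (![0, 0, 0, 0, a, b, c, 0] : Fin 8 → Fin 8) (tau t 4) ≤ ![0, 0, 0, 0, a, b, c, 0] (tau t 5) ∧
    (![0, 0, 0, 0, a, b, c, 0] : Fin 8 → Fin 8) (tau t 5) ≤ ![0, 0, 0, 0, a, b, c, 0] (tau t 6) := by
  decide +kernel

/-- Reading `![D 0, D 1, D 2, D 3, 0, …]` at an index `< 4`. [folklore] -/
theorem vec4a_apply (D : Fin 8 → Fin 8) :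
    ∀ j : Fin 8, j.val < 4 → (![D 0, D 1, D 2, D 3, 0, 0, 0, 0] : Fin 8 → Fin 8) j = D j := by
  intro j hj
  fin_cases j <;> simp_all

/-- Reading `![0, 0, 0, 0, D 4, D 5, D 6, 0]` at an index in `[4,7)`. [folklore] -/
theorem vec3b_apply (D : Fin 8 → Fin 8) :
    ∀ j : Fin 8, 4 ≤ j.val → j.val < 7 → (![0, 0, 0, 0, D 4, D 5, D 6, 0] : Fin 8 → Fin 8) j = D j := by
  intro j hj hj'
  fin_cases j <;> simp_all

/-- **Sorted normal form (blocks `{0,1,2,3}`, `{4,5,6}`).** [folklore] -/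
theorem exists_blockSort3 (D : Fin 8 → Fin 8) : ∃ σ : Fin 8 → Fin 8, Function.Injective σ ∧ σ 7 = 7 ∧
    (∀ j : Fin 8, j.val < 7 → (4 ≤ (σ j).val ↔ 4 ≤ j.val)) ∧
    D (σ 0) ≤ D (σ 1) ∧ D (σ 1) ≤ D (σ 2) ∧ D (σ 2) ≤ D (σ 3) ∧ D (σ 4) ≤ D (σ 5) ∧ D (σ 5) ≤ D (σ 6) := by
  obtain ⟨p, hp, h01, h12, h23⟩ := sort4a (D 0) (D 1) (D 2) (D 3)
  obtain ⟨q, hq, h45, h56⟩ := sort3b (D 4) (D 5) (D 6)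
  obtain ⟨hαi, hαfix, hαlt⟩ := T4a_block p hp
  obtain ⟨hβi, hβfix, hβ7, hβin⟩ := T3b_block q hq
  have b0 : tau q 0 = 0 := hβfix 0 (by decide)
  have b1 : tau q 1 = 1 := hβfix 1 (by decide)
  have b2 : tau q 2 = 2 := hβfix 2 (by decide)
  have b3 : tau q 3 = 3 := hβfix 3 (by decide)
  have i4 := hβin 4 (by decide) (by decide)
  have i5 := hβin 5 (by decide) (by decide)
  have i6 := hβin 6 (by decide) (by decide)
  refine ⟨fun j => tau p (tau q j), hαi.comp hβi, ?_, ?_, ?_, ?_, ?_, ?_, ?_⟩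
  · show tau p (tau q 7) = 7
    rw [hβ7, hαfix 7 (by decide)]
  · intro j hj7
    show 4 ≤ (tau p (tau q j)).val ↔ 4 ≤ j.val
    by_cases hj : j.val < 4
    · rw [hβfix j hj]
      have := hαlt j hj
      constructor <;> intro h <;> omega
    · have hin := hβin j (by omega) hj7
      rw [hαfix (tau q j) hin.1]
      constructor <;> intro _ <;> omega
  · show D (tau p (tau q 0)) ≤ D (tau p (tau q 1))
    rw [b0, b1]
    rwa [vec4a_apply D _ (hαlt 0 (by decide)), vec4a_apply D _ (hαlt 1 (by decide))] at h01
  · show D (tau p (tau q 1)) ≤ D (tau p (tau q 2))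
    rw [b1, b2]
    rwa [vec4a_apply D _ (hαlt 1 (by decide)), vec4a_apply D _ (hαlt 2 (by decide))] at h12
  · show D (tau p (tau q 2)) ≤ D (tau p (tau q 3))
    rw [b2, b3]
    rwa [vec4a_apply D _ (hαlt 2 (by decide)), vec4a_apply D _ (hαlt 3 (by decide))] at h23
  · show D (tau p (tau q 4)) ≤ D (tau p (tau q 5))
    rw [hαfix _ i4.1, hαfix _ i5.1]
    rwa [vec3b_apply D _ i4.1 i4.2, vec3b_apply D _ i5.1 i5.2] at h45
  · show D (tau p (tau q 5)) ≤ D (tau p (tau q 6))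
    rw [hαfix _ i5.1, hαfix _ i6.1]
    rwa [vec3b_apply D _ i5.1 i5.2, vec3b_apply D _ i6.1 i6.2] at h56

end EightCensus3

end Summit.Ventures.Crystal3D

end
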